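/-
Copyright (c) 2026 the pub-hodgecm-mathlib formalisation cell (harness21).  Prover seat hodgecm-mathlib-K2Liu-p08 (g6), Track B «K2-LIT»,
#184♮ = hLiu418 = `stmt-HodgeConjecture-24832`; #42S BLOCK D, row D-2, (σ-A) mini-road (LEAD F0P6-plan (g15) RULING M-160f ∕ BATCH #238; (σ-A) road desk
K2Liu-p25 (g3) WORDs #15, #17, #22, #23), brick (an-3c) CORE: THE CONE WORD FROM THE STAGE LETTERS — the measure-theoretic assembly, [A1]-free.
THEOREMS ONLY (no `def`, no `instance`, no `notation`, no named-fact hypothesis, no `sorry`, default heartbeats).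
-/
import Summits.HodgeConjecture.HodgeConjecture.Theorems.K2LiuCornerZetaStageInversion   -- ★ p864380 (an-2): `integral_integral_addChar_linear_mul_slice_eq` (the ζ-stage engine, unfolded)
import HarnessLib

/-!
# Crux `HLiu418`, #42S BLOCK D, row D-2, (σ-A) brick (an-3c) CORE: THE CONE WORD FROM THE STAGE LETTERS (abstract Fubini assembly)

Cell `hodgecm-mathlib`, crux item hLiu418 = `stmt-HodgeConjecture-24832` (helper lane `--supports … --as helper`, count-neutral; closes no socket); squad K2 ∕ K2Liu (L1).
Prover K2Liu-p08 (g6) = pen of [A4]∕(an-3) under the (σ-A) road desk K2Liu-p25 (g3).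

THE CHAIN (census K2Liu-p08 2026-09-05T01:59Z, desk WORD #15 «=»).  At a bad place, the stage-B value `N₂val(x)` of the #42S corner is, letter by letter:
(L1) the ζ-STAGE `N₂val x = c_E · ∫_ζ N₁(x, ζ) dμ^κ(ζ)` (★ `chainValues_of_placeLetter` (e′) at `s₀ = ½`);
(L2) the y-STAGE through (an-1)'s null-cone measure and [A1-ζ]'s Levi reading: `N₁(x, ζ) = c_F · ∫_s V_x((Z_s ζ) ⊔ s) dσ(s)` (★ [A3] FILE 2 `stageA_half_of_word` +
     ★ (an-1) `exists_nullConeMeasure`'s Schwartz–Bruhat identity + ★ p864240 [A1] y-stage word + ★ p864336 [A1-ζ]: after `w₁`'s swap and `u₋(ζ)`'s shear the vector of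
     `g_x = φ(w₂)φ(u(xδ))h` is read at the graph point `(ζ·s) ⊔ s`);
(L3) (W-w₂)@point (F0P2-p07 `K2LiuLocalSWCornerVectorAtPoint` §3, operator form, unfolded by ★ [A2] p864180): `V_x(q₁ ⊔ q₂) = γ · ∫_t ψ(t ⬝ᵥ q₁) · Θ_x(t ⊔ q₂) dμ^{ι₁}(t)`;
(L4) the PHASE SPLIT `Θ_x(v) = ψ(x · q_f v) · G₀(v)` (`Θ_x = (leviOpPi B₁ ⊠ 1)(unipOpPi (x•c₁) Ξ_h)`: `q_f = −halfForm c₁ ∘ (B₁⁻¹ ⊕ id)`, `G₀ = |det B₁|^{−1∕2}·Ξ_h ∘ (B₁⁻¹ ⊕ id)`);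
(L5) a measurable family of ADAPTED FRAMES `A_s` for `Z_s` off the vertex (★ p864435 (an-3a) on the max-coordinate charts, (an-3c-charts) K2Liu-p12);
(I1), (I2) the two `L¹` letters (★ (an-3b) `K2LiuConeVertexFubini`: fibre mass `≍ ‖s‖^{−card κ}` against `σ`'s vertex law).
THIS FILE proves, from exactly these letters BY VALUE and ★ (an-2), the CONE WORD of ★ p864360 [A4-close] §4:
  **`N₂val x = γ_tot · ∫_{(s,b)} ψ(x · q(s,b)) · G(s,b) d(σ ⊗ μ^{ι₂})`**, `q(s,b) := q_f(A_s(0 ⊔ b) ⊔ s)`, `G(s,b) := c_κ·|det A_s|·G₀(A_s(0 ⊔ b) ⊔ s)`, `γ_tot = c_E·c_F·γ`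
— two Fubini swaps (`ζ ↔ s` by (I1); `(s, b)` product by (I2)) around ★ p864380's inversion along `ζ ↦ Z_s ζ` at each `s ≠ 0` (`σ{0} = 0`).
* §1 **`coneWord_of_stageLetters`** (the theorem above); §2 **`ae_prod_fst_of_null`** — `σ S = 0 ⇒ (σ ⊗ ν)`-a.e. `z.1 ∉ S` (the `s ≠ 0`, `Q s = 0` half of `hZ`;
  the `t ⊥ s` half is the frames' adaptedness, ★ p864435 `frame_glue_zero_dotProduct_apply_eq_zero`, and the class is ★ p864316 [A4-alg]).
[KudlaRallis1994, §2 (2.10)–(2.12)] [MoeglinVignerasWaldspurger1987, Chap. 2 II.6] [WeilBNT1967, Chap. VII §2 Cor. 1] [Weil1965, Chap. III n° 37 Prop. 6].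
HONEST LABEL.  Count-neutral helper; (L1)–(L5), (I1), (I2) enter BY VALUE (their payers: ★ p863595, ★ [A3], ★ (an-1) (LH4-p07), ★ p864240∕p864336 [A1], (W-w₂)@point
(F0P2-p07), ★ p864435 + (an-3c-charts) (K2Liu-p12), ★ (an-3b)); `HC_CM` is proved only modulo the 7 printed citations (2 remaining named inputs: hLiu418 =
`stmt-HodgeConjecture-24832`, h413 = `stmt-HodgeConjecture-24833`) until rung 0 closes.  NOT here: the telescope instantiation at the #42S record ((an-3c) §3).

## References
* [KudlaRallis1994] S. Kudla, S. Rallis, *A regularized Siegel–Weil formula: the first term identity*, Ann. of Math. 140 (1994), §2 (2.10)–(2.12).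
* [MoeglinVignerasWaldspurger1987] C. Mœglin, M.-F. Vignéras, J.-L. Waldspurger, LNM 1291 (1987), Chap. 2 II.6.
* [WeilBNT1967] A. Weil, *Basic Number Theory* (1967), Chap. VII §2, Cor. 1.
* [Weil1965] A. Weil, *Sur la formule de Siegel dans la théorie des groupes classiques*, Acta Math. 113 (1965), Chap. III n° 37 Prop. 6.
-/

set_option autoImplicit false
set_option linter.dupNamespace false -- the mandated namespace repeats `HodgeConjecture.HodgeConjecture`

noncomputable section

open MeasureTheory Set Filter Function
open scoped Matrix NNReal ENNReal
open Literature.NumberTheory.Automorphic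
open Literature.NumberTheory.GaloisRepresentations Literature.NumberTheory.GaloisRepresentations.IsNonarchimedeanLocalField
open Literature.RepresentationTheory.HeisenbergGroup
open Summit.HodgeConjecture.HodgeConjecture.Cruxes.HLiu418

namespace Summit.HodgeConjecture.HodgeConjecture.Cruxes.HLiu418.K2LiuStageFunctionalConeWord

/-! ## §1 The cone word from the stage letters -/

section Assembly

variable {F : Type*} [Field F] [ValuativeRel F] [TopologicalSpace F] [IsNonarchimedeanLocalField F]
  [MeasurableSpace F] [BorelSpace F] (μ : Measure F) [μ.IsAddHaarMeasure]
  {ψ : AddChar F Circle} (hψ : ψ.IsContinuousNontrivial) {m : ℤ} (hm : ψ.HasConductorExp m)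
  {κ ι₂ ι₁ ι₁' ι : Type*} [Fintype κ] [Fintype ι₂] [Fintype ι₁]
  (e : ι₁ ⊕ ι₁' ≃ ι) (eA : κ ⊕ ι₂ ≃ ι₁)

include hψ hm in
/-- **THE CONE WORD FROM THE STAGE LETTERS.**  `μ` Haar on the local field `F`, `ψ` of conductor exponent `m`, `c_κ = piSelfDualConst F κ μ^κ m`; the two-block model
`F^ι = F^{ι₁} ⊔ F^{ι₁′}` (`e`) with the `ζ`-splitting `eA : κ ⊕ ι₂ ≃ ι₁`; BY VALUE: the cone measure `σ` on the position block (`σ{0} = 0`, s-finite), the graph maps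
`Z_s : F^κ →ₗ F^{ι₁}`, a family of frames `A_s` ADAPTED to `Z_s` off the vertex (`hA`), the stage values `N₂val`, `N₁`, the vector values `V_x`, the position functions
`Θ_x ∈ 𝒮(F^ι)` with the phase split `Θ_x = ψ(x·q_f)·G₀`, the letters (L1) `N₂val x = c_E·∫ N₁ x ζ`, (L2) `N₁ x ζ = c_F·∫ V_x((Z_s ζ) ⊔ s) dσ`,
(L3) `V_x(q₁ ⊔ q₂) = γ·∫_t ψ(t ⬝ᵥ q₁)·Θ_x(t ⊔ q₂)`, and the two `L¹` letters (I1) (`ζ ↔ s`) and (I2) (`(s,b)`).  THEN for every `x`: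
**`N₂val x = (c_E·c_F·γ) · ∫ ψ(x · q_f(A_s(0⊔b) ⊔ s)) · (c_κ·|det A_s|·G₀(A_s(0⊔b) ⊔ s)) d(σ ⊗ μ^{ι₂})(s,b)`** — ★ p864360 [A4-close] §4's `hcone` shape with
`Z := F^{ι₁′} × F^{ι₂}`, `ρ := σ ⊗ μ^{ι₂}`, `q (s,b) := q_f(A_s(0⊔b) ⊔ s)`, `G (s,b) := c_κ·|det A_s|·G₀(A_s(0⊔b) ⊔ s)`.  Proof: (L1)(L2), Fubini `ζ ↔ s` (I1),
★ (an-2) `integral_integral_addChar_linear_mul_slice_eq` at each `s ≠ 0` (σ-a.e.), Fubini for the product (I2), the phase split.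
[cite: KudlaRallis1994, §2 (2.10)–(2.12)] [cite: MoeglinVignerasWaldspurger1987, Chap. 2 II.6] [cite: WeilBNT1967, Chap. VII §2, Cor. 1] -/
theorem coneWord_of_stageLetters
    (σ : Measure (ι₁' → F)) [SFinite σ] (hσ0 : σ {0} = 0)
    (Zm : (ι₁' → F) → ((κ → F) →ₗ[F] (ι₁ → F)))
    (A : (ι₁' → F) → ((ι₁ → F) ≃ₗ[F] (ι₁ → F)))
    (hA : ∀ s : ι₁' → F, s ≠ 0 → ∀ (t : ι₁ → F) (ζ : κ → F), A s t ⬝ᵥ Zm s ζ = resL eA t ⬝ᵥ ζ)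
    (x : F) (N₂val : F → ℂ) (N₁ : F → (κ → F) → ℂ) (V : F → (ι → F) → ℂ) (Θ : F → SchwartzBruhat (ι → F))
    (qf : (ι → F) → F) (G₀ : (ι → F) → ℂ) (cE cF γ : ℂ)
    (hL1 : N₂val x = cE * ∫ ζ, N₁ x ζ ∂(Measure.pi fun _ : κ => μ))
    (hL2 : ∀ ζ : κ → F, N₁ x ζ = cF * ∫ s, V x (glue e (Zm s ζ) s) ∂σ)
    (hL3 : ∀ (q₁ : ι₁ → F) (q₂ : ι₁' → F),
      V x (glue e q₁ q₂) = γ * ∫ t, ((ψ (t ⬝ᵥ q₁) : Circle) : ℂ) * (Θ x : (ι → F) → ℂ) (glue e t q₂) ∂(Measure.pi fun _ : ι₁ => μ))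
    (hL4 : ∀ v : ι → F, (Θ x : (ι → F) → ℂ) v = ((ψ (x * qf v) : Circle) : ℂ) * G₀ v)
    (hI1 : Integrable (uncurry fun (ζ : κ → F) (s : ι₁' → F) => V x (glue e (Zm s ζ) s)) ((Measure.pi fun _ : κ => μ).prod σ))
    (hI2 : Integrable (fun p : (ι₁' → F) × (ι₂ → F) =>
      (normAbs F (LinearMap.det (A p.1 : (ι₁ → F) →ₗ[F] (ι₁ → F))) : ℂ) * (Θ x : (ι → F) → ℂ) (glue e (A p.1 (glue eA 0 p.2)) p.1))
      (σ.prod (Measure.pi fun _ : ι₂ => μ))) :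
    N₂val x = (cE * cF * γ) *
      ∫ p, ((ψ (x * qf (glue e (A p.1 (glue eA 0 p.2)) p.1)) : Circle) : ℂ) *
        ((piSelfDualConst F κ (Measure.pi fun _ : κ => μ) m : ℂ) * (normAbs F (LinearMap.det (A p.1 : (ι₁ → F) →ₗ[F] (ι₁ → F))) : ℂ) *
          G₀ (glue e (A p.1 (glue eA 0 p.2)) p.1)) ∂(σ.prod (Measure.pi fun _ : ι₂ => μ)) := by
  haveI : SecondCountableTopology F := secondCountableTopology_localField F
  -- (L1) + (L2): the iterated `ζ`, `s` integral
  have h12 : N₂val x = cE * (cF * ∫ ζ, ∫ s, V x (glue e (Zm s ζ) s) ∂σ ∂(Measure.pi fun _ : κ => μ)) := by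
    rw [hL1]
    congr 1
    rw [← integral_const_mul]
    exact integral_congr_ae (Eventually.of_forall fun ζ => hL2 ζ)
  -- Fubini `ζ ↔ s` (I1)
  have hswap : ∫ ζ, ∫ s, V x (glue e (Zm s ζ) s) ∂σ ∂(Measure.pi fun _ : κ => μ) =
      ∫ s, ∫ ζ, V x (glue e (Zm s ζ) s) ∂(Measure.pi fun _ : κ => μ) ∂σ :=
    integral_integral_swap hI1
  -- the inner `ζ`-integral at `s ≠ 0`: ★ (an-2)'s inversion along `ζ ↦ Z_s ζ` with the adapted frame `A_s`
  have hinner : ∀ s : ι₁' → F, s ≠ 0 →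
      ∫ ζ, V x (glue e (Zm s ζ) s) ∂(Measure.pi fun _ : κ => μ) =
        γ * ((piSelfDualConst F κ (Measure.pi fun _ : κ => μ) m : ℂ) * (normAbs F (LinearMap.det (A s : (ι₁ → F) →ₗ[F] (ι₁ → F))) : ℂ) *
          ∫ b, (Θ x : (ι → F) → ℂ) (glue e (A s (glue eA 0 b)) s) ∂(Measure.pi fun _ : ι₂ => μ)) := by
    intro s hs
    have h3 : (fun ζ : κ → F => V x (glue e (Zm s ζ) s)) =
        fun ζ => γ * ∫ t, ((ψ (t ⬝ᵥ Zm s ζ) : Circle) : ℂ) * (Θ x : (ι → F) → ℂ) (glue e t s) ∂(Measure.pi fun _ : ι₁ => μ) :=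
      funext fun ζ => hL3 (Zm s ζ) s
    rw [h3, integral_const_mul,
      K2LiuCornerZetaStageInversion.integral_integral_addChar_linear_mul_slice_eq eA (Zm s) (A s) μ hψ hm e (hA s hs) (Θ x).2 s]
  -- hence σ-a.e. (the vertex is σ-null)
  have hae : (fun s : ι₁' → F => ∫ ζ, V x (glue e (Zm s ζ) s) ∂(Measure.pi fun _ : κ => μ)) =ᵐ[σ]
      fun s => γ * ((piSelfDualConst F κ (Measure.pi fun _ : κ => μ) m : ℂ) * (normAbs F (LinearMap.det (A s : (ι₁ → F) →ₗ[F] (ι₁ → F))) : ℂ) *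
        ∫ b, (Θ x : (ι → F) → ℂ) (glue e (A s (glue eA 0 b)) s) ∂(Measure.pi fun _ : ι₂ => μ)) := by
    have h0 : ∀ᵐ s ∂σ, s ∉ ({0} : Set (ι₁' → F)) := measure_eq_zero_iff_ae_notMem.1 hσ0
    filter_upwards [h0] with s hs
    exact hinner s (fun h => hs (h ▸ mem_singleton _))
  -- Fubini for the product `(s, b)` (I2), then the phase split (L4)
  have hprod : ∫ s, (normAbs F (LinearMap.det (A s : (ι₁ → F) →ₗ[F] (ι₁ → F))) : ℂ) *
        ∫ b, (Θ x : (ι → F) → ℂ) (glue e (A s (glue eA 0 b)) s) ∂(Measure.pi fun _ : ι₂ => μ) ∂σ =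
      ∫ p, (normAbs F (LinearMap.det (A p.1 : (ι₁ → F) →ₗ[F] (ι₁ → F))) : ℂ) *
        (Θ x : (ι → F) → ℂ) (glue e (A p.1 (glue eA 0 p.2)) p.1) ∂(σ.prod (Measure.pi fun _ : ι₂ => μ)) := by
    rw [integral_prod _ hI2]
    refine integral_congr_ae (Eventually.of_forall fun s => ?_)
    exact (integral_const_mul _ _).symm
  calc N₂val x
      = cE * (cF * ∫ s, ∫ ζ, V x (glue e (Zm s ζ) s) ∂(Measure.pi fun _ : κ => μ) ∂σ) := by rw [h12, hswap]
    _ = cE * (cF * ∫ s, γ * ((piSelfDualConst F κ (Measure.pi fun _ : κ => μ) m : ℂ) *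
          (normAbs F (LinearMap.det (A s : (ι₁ → F) →ₗ[F] (ι₁ → F))) : ℂ) *
          ∫ b, (Θ x : (ι → F) → ℂ) (glue e (A s (glue eA 0 b)) s) ∂(Measure.pi fun _ : ι₂ => μ)) ∂σ) := by rw [integral_congr_ae hae]
    _ = (cE * cF * γ) * ((piSelfDualConst F κ (Measure.pi fun _ : κ => μ) m : ℂ) *
          ∫ s, (normAbs F (LinearMap.det (A s : (ι₁ → F) →ₗ[F] (ι₁ → F))) : ℂ) *
            ∫ b, (Θ x : (ι → F) → ℂ) (glue e (A s (glue eA 0 b)) s) ∂(Measure.pi fun _ : ι₂ => μ) ∂σ) := by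
          rw [← integral_const_mul, ← integral_const_mul, ← integral_const_mul, ← integral_const_mul]
          refine integral_congr_ae (Eventually.of_forall fun s => ?_)
          ring
    _ = (cE * cF * γ) * ((piSelfDualConst F κ (Measure.pi fun _ : κ => μ) m : ℂ) *
          ∫ p, (normAbs F (LinearMap.det (A p.1 : (ι₁ → F) →ₗ[F] (ι₁ → F))) : ℂ) *
            (Θ x : (ι → F) → ℂ) (glue e (A p.1 (glue eA 0 p.2)) p.1) ∂(σ.prod (Measure.pi fun _ : ι₂ => μ))) := by rw [hprod]
    _ = (cE * cF * γ) * ∫ p, ((ψ (x * qf (glue e (A p.1 (glue eA 0 p.2)) p.1)) : Circle) : ℂ) *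
          ((piSelfDualConst F κ (Measure.pi fun _ : κ => μ) m : ℂ) * (normAbs F (LinearMap.det (A p.1 : (ι₁ → F) →ₗ[F] (ι₁ → F))) : ℂ) *
            G₀ (glue e (A p.1 (glue eA 0 p.2)) p.1)) ∂(σ.prod (Measure.pi fun _ : ι₂ => μ)) := by
          rw [← integral_const_mul]
          congr 1
          refine integral_congr_ae (Eventually.of_forall fun p => ?_)
          dsimp only
          rw [hL4]
          ring

end Assembly

/-! ## §2 The support half of `hZ` that lives on the cone variable: product-null sets -/

section Support

/-- **`σ S = 0 ⇒ (σ ⊗ ν)`-a.e. `z.1 ∉ S`** (`ν` ANY measure, possibly infinite: `(σ ⊗ ν)(S × univ) ≤ σ S · ν univ = 0`).  At use: `S = {0}` and `S = {Q ≠ 0}` for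
(an-1)'s null-cone measure — the `s ≠ 0`, `Q s = 0` clauses of ★ p864360's support letter `hZ`; the `t ⊥ s` clause is the frame's adaptedness
(★ p864435 `frame_glue_zero_dotProduct_apply_eq_zero`) and the class is ★ p864316 [A4-alg] §3. [cite: KudlaRallis1994, §2 (2.10)–(2.12)] -/
theorem ae_prod_fst_notMem_of_null {X Y : Type*} [MeasurableSpace X] [MeasurableSpace Y] (σ : Measure X) (ν : Measure Y) [SFinite ν]
    {S : Set X} (hS : σ S = 0) : ∀ᵐ z ∂(σ.prod ν), z.1 ∉ S := by
  have h : (σ.prod ν) (Prod.fst ⁻¹' S) = 0 := by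
    refine le_antisymm ?_ bot_le
    calc (σ.prod ν) (Prod.fst ⁻¹' S) ≤ (σ.prod ν) (S ×ˢ (univ : Set Y)) := measure_mono fun z hz => ⟨hz, mem_univ _⟩
      _ ≤ σ S * ν univ := Measure.prod_prod_le S univ
      _ = 0 := by rw [hS, zero_mul]
  exact measure_eq_zero_iff_ae_notMem.1 h

end Support

end Summit.HodgeConjecture.HodgeConjecture.Cruxes.HLiu418.K2LiuStageFunctionalConeWord

end
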